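import Mathlib

/-!
# `DivisionGap.PerCofactorDegreeReduction` (stmt-ValiantsHypothesis-15046), line `Sketch_ideator4`
(idea intrinsic-member-descent): gadget placement on a Hamiltonian 2-factor
(stub `stub_gadgetPlacement`)

Cells are `(row, col)`; a permutation `σ` is the perfect matching with cells `(σ i, i)`.  Let
`H₀ = π₀ ⊔ ρ₀` with `τ = π₀⁻¹ρ₀` an `n`-cycle, so that the orbit `col t = τ^t c₀` (`t < n`)
enumerates all columns and, with `row t = ρ₀ (col t)`, the 2-factor `H₀` is the Hamiltonian cycle
`… col t — row t — col (t+1) — row (t+1) …` (`π₀ (col (t+1)) = row t`).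

* Slots: for `s < K = b + b²` (`b = ⌊√(n/24)⌋`, `6K + 1 ≤ n`) the gadget row `R s = row (6s)` and
  the gadget column `C s = col (6s+3)`; the `H₀`-neighbours of `C s` are the rows `6s+2, 6s+3`,
  never a gadget row.
* The host is `A = H₀ ∪ {gadget cells}`, every gadget cell having a gadget row and a gadget
  column; hence every chord of `A` has its column `H₀`-non-adjacent to every chord row
  (the rigidity hypothesis of `stub_twoFactorRigidity`).
* The leftover matching `μ` is defined along the orbit by a bijection `φ` of `{0, …, n-1}`:
  block `s` sends the columns `6s+1, 6s+2 ↦` rows `6s+1, 6s+2` (via `ρ₀`), the gadget column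
  `6s+3 ↦` row `6s`, the columns `6s+4, 6s+5, 6s+6 ↦` rows `6s+3, 6s+4, 6s+5` (via `π₀`), and the
  tail columns `t > 6K`, `t = 0` go to row `t - 1` (via `π₀`).  On a leftover column `μ` is an
  `H₀`-edge whose row is not a gadget row.
[folklore]
-/

noncomputable section

-- `Summit.ValiantsHypothesis.ValiantsHypothesis.…` is the tree's mandated single-conjunct layout
-- (Sub = Summit), so the duplicated namespace component is intended.
set_option linter.dupNamespace false

namespace Summit.ValiantsHypothesis.ValiantsHypothesis.Theorems.DivisionGap.PerCofactorDegreeReduction.GadgetPlacement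

/-! ### The orbit enumeration of a Hamiltonian 2-factor -/

/-- The orbit of an `n`-cycle `τ = π₀⁻¹ρ₀` through `c₀` enumerates `Fin n` bijectively by
`t ↦ τ^t c₀` (`t < n`), with `π₀ (col (t+1)) = ρ₀ (col t)` and period `n`. [folklore] -/
theorem exists_orbit {n : ℕ} (hn : 1 ≤ n) (π₀ ρ₀ : Equiv.Perm (Fin n))
    (hc : (π₀⁻¹ * ρ₀).IsCycle) (hs : (π₀⁻¹ * ρ₀).support = Finset.univ) :
    ∃ col : ℕ → Fin n, (∀ t, π₀ (col (t + 1)) = ρ₀ (col t)) ∧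
      (∀ s t, s < n → t < n → col s = col t → s = t) ∧ (∀ c, ∃ t < n, col t = c) ∧
      col n = col 0 := by
  obtain ⟨τ, hτ⟩ : ∃ τ, τ = π₀⁻¹ * ρ₀ := ⟨_, rfl⟩
  rw [← hτ] at hc hs
  have hτapp : ∀ x, π₀ (τ x) = ρ₀ x := fun x => by
    rw [hτ, Equiv.Perm.mul_apply, Equiv.Perm.inv_def, Equiv.apply_symm_apply]
  have c₀ : Fin n := ⟨0, hn⟩
  have hcyc : τ.IsCycleOn ((Finset.univ : Finset (Fin n)) : Set (Fin n)) := by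
    convert hc.isCycleOn using 1
    ext x
    simp only [Finset.coe_univ, Set.mem_univ, Set.mem_setOf_eq, true_iff]
    exact Equiv.Perm.mem_support.mp (hs ▸ Finset.mem_univ x)
  have hcard : (Finset.univ : Finset (Fin n)).card = n := Finset.card_fin n
  refine ⟨fun t => (τ ^ t) c₀, fun t => ?_, fun s t hs' ht h => ?_, fun c => ?_, ?_⟩
  · show π₀ ((τ ^ (t + 1)) c₀) = ρ₀ ((τ ^ t) c₀)
    rw [pow_succ', Equiv.Perm.mul_apply, hτapp]
  · have h' := (hcyc.pow_apply_eq_pow_apply (Finset.mem_univ c₀)).1 h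
    rw [hcard] at h'
    exact Nat.ModEq.eq_of_lt_of_lt h' hs' ht
  · obtain ⟨t, ht, h⟩ := hcyc.exists_pow_eq (Finset.mem_univ c₀) (Finset.mem_univ c)
    exact ⟨t, hcard ▸ ht, h⟩
  · have h := hcyc.pow_card_apply (Finset.mem_univ c₀)
    rw [hcard] at h
    simp only [h, pow_zero, Equiv.Perm.one_apply]

/-! ### The leftover bijection along the orbit -/

/-- The index-level leftover bijection `φ` of `{0, …, n-1}` (`6K + 1 ≤ n`): injective, and on every
index `t` that is not a gadget column index `6s+3` (`s < K`) it is `t`, `t - 1` or (for `t = 0`)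
`n - 1`, and never a gadget row index `6s` (`s < K`). [folklore] -/
theorem exists_phi (n K : ℕ) (hKn : 6 * K + 1 ≤ n) :
    ∃ φ : ℕ → ℕ, (∀ t < n, φ t < n) ∧ (∀ s t, s < n → t < n → φ s = φ t → s = t) ∧
      (∀ t < n, ¬(t < 6 * K ∧ t % 6 = 3) →
        (φ t = t ∨ (1 ≤ t ∧ φ t = t - 1) ∨ (t = 0 ∧ φ t = n - 1)) ∧ ∀ s < K, φ t ≠ 6 * s) := by
  refine ⟨fun t => if t < 6 * K ∧ (t % 6 = 1 ∨ t % 6 = 2) then t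
      else if t < 6 * K ∧ t % 6 = 3 then t - 3 else if t = 0 then n - 1 else t - 1,
    fun t ht => ?_, fun s t hs ht h => ?_, fun t ht hleft => ⟨?_, fun s hs => ?_⟩⟩
  · dsimp only
    split_ifs <;> omega
  · dsimp only at h
    split_ifs at h <;> omega
  · dsimp only
    split_ifs <;> omega
  · dsimp only
    split_ifs <;> omega

/-- Transport of the index bijection `φ` through the orbit: a permutation `μ` of the columns with
`μ (col t) = ρ₀ (col (φ t))`. [folklore] -/
theorem exists_mu {n : ℕ} (ρ₀ : Equiv.Perm (Fin n)) (col : ℕ → Fin n)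
    (hinj : ∀ s t, s < n → t < n → col s = col t → s = t) (hsurj : ∀ c, ∃ t < n, col t = c)
    (φ : ℕ → ℕ) (hφlt : ∀ t < n, φ t < n) (hφinj : ∀ s t, s < n → t < n → φ s = φ t → s = t) :
    ∃ μ : Equiv.Perm (Fin n), ∀ t < n, μ (col t) = ρ₀ (col (φ t)) := by
  classical
  choose idx hidx_lt hidx_eq using hsurj
  have hidx : ∀ t < n, idx (col t) = t := fun t ht => hinj _ _ (hidx_lt _) ht (hidx_eq _)
  set f : Fin n → Fin n := fun c => ρ₀ (col (φ (idx c)))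
  have hf : Function.Injective f := by
    intro c c' h
    have h3 := hφinj _ _ (hidx_lt c) (hidx_lt c')
      (hinj _ _ (hφlt _ (hidx_lt c)) (hφlt _ (hidx_lt c')) (ρ₀.injective h))
    calc c = col (idx c) := (hidx_eq c).symm
      _ = col (idx c') := by rw [h3]
      _ = c' := hidx_eq c'
  refine ⟨Equiv.ofBijective f (Finite.injective_iff_bijective.mp hf), fun t ht => ?_⟩
  show ρ₀ (col (φ (idx (col t)))) = ρ₀ (col (φ t))
  rw [hidx t ht]

/-! ### The construction for a general gadget order `b` -/

/-- The gadget placement for a general gadget order `b` with `6 (b + b²) + 1 ≤ n`, given the orbit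
enumeration `col` of the Hamiltonian 2-factor `π₀ ⊔ ρ₀`. [folklore] -/
theorem placement {n : ℕ} (hn : 1 ≤ n) (π₀ ρ₀ : Equiv.Perm (Fin n)) (b : ℕ)
    (hKn : 6 * (b + b * b) + 1 ≤ n) (col : ℕ → Fin n)
    (hstep : ∀ t, π₀ (col (t + 1)) = ρ₀ (col t))
    (hinj : ∀ s t, s < n → t < n → col s = col t → s = t) (hsurj : ∀ c, ∃ t < n, col t = c)
    (hper : col n = col 0) :
    ∃ A : Finset (Fin n × Fin n),
      (∀ i, (π₀ i, i) ∈ A ∧ (ρ₀ i, i) ∈ A) ∧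
      (∀ e ∈ A, ∀ e' ∈ A, π₀ e.2 ≠ e.1 → ρ₀ e.2 ≠ e.1 → π₀ e'.2 ≠ e'.1 → ρ₀ e'.2 ≠ e'.1 →
        e ≠ e' → π₀ e.2 ≠ e'.1 ∧ ρ₀ e.2 ≠ e'.1) ∧
      ∃ (ra cb : Fin b → Fin n) (xc yr : Fin b × Fin b → Fin n) (μ : Equiv.Perm (Fin n)),
        Function.Injective ra ∧ Function.Injective cb ∧ Function.Injective xc ∧
        Function.Injective yr ∧
        (∀ a p, ra a ≠ yr p) ∧ (∀ b' p, cb b' ≠ xc p) ∧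
        (∀ p, (ra p.1, xc p) ∈ A ∧ (yr p, xc p) ∈ A ∧ (yr p, cb p.2) ∈ A) ∧
        (∀ c : Fin n, (∀ b', cb b' ≠ c) → (∀ p, xc p ≠ c) →
          (∀ a, ra a ≠ μ c) ∧ (∀ p, yr p ≠ μ c) ∧ (μ c, c) ∈ A) := by
  -- the number of slots
  obtain ⟨K, hK⟩ : ∃ K, K = b + b * b := ⟨_, rfl⟩
  rw [← hK] at hKn
  have hbK : b ≤ K := hK ▸ Nat.le_add_right b (b * b)
  -- rows are injective along the orbit
  have hrow : ∀ s t, s < n → t < n → ρ₀ (col s) = ρ₀ (col t) → s = t :=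
    fun s t hs ht h => hinj s t hs ht (ρ₀.injective h)
  -- the internal slots `b ≤ slot p < K`
  obtain ⟨slot, hslot_inj, hslot, hslot_surj⟩ : ∃ slot : Fin b × Fin b → ℕ,
      Function.Injective slot ∧ (∀ p, b ≤ slot p ∧ slot p < K) ∧
      ∀ s, b ≤ s → s < K → ∃ p, slot p = s := by
    refine ⟨fun p => b + (finProdFinEquiv p).val, fun p q h => ?_, fun p => ⟨?_, ?_⟩,
      fun s hbs hsK => ?_⟩
    · exact finProdFinEquiv.injective (Fin.ext (by simpa using h))
    · exact Nat.le_add_right _ _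
    · show b + (finProdFinEquiv p).val < K
      have := (finProdFinEquiv p).isLt
      omega
    · refine ⟨finProdFinEquiv.symm ⟨s - b, by rw [hK] at hsK; omega⟩, ?_⟩
      simp only [Equiv.apply_symm_apply]
      omega
  -- the placed vertices
  obtain ⟨ra, hra⟩ : ∃ ra : Fin b → Fin n, ∀ a, ra a = ρ₀ (col (6 * a.val)) := ⟨_, fun _ => rfl⟩
  obtain ⟨yr, hyr⟩ : ∃ yr : Fin b × Fin b → Fin n, ∀ p, yr p = ρ₀ (col (6 * slot p)) :=
    ⟨_, fun _ => rfl⟩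
  obtain ⟨cb, hcb⟩ : ∃ cb : Fin b → Fin n, ∀ b', cb b' = col (6 * b'.val + 3) :=
    ⟨_, fun _ => rfl⟩
  obtain ⟨xc, hxc⟩ : ∃ xc : Fin b × Fin b → Fin n, ∀ p, xc p = col (6 * slot p + 3) :=
    ⟨_, fun _ => rfl⟩
  -- the host
  obtain ⟨A, hA⟩ : ∃ A : Finset (Fin n × Fin n), ∀ e, e ∈ A ↔
      ((∃ i, (π₀ i, i) = e) ∨ ∃ i, (ρ₀ i, i) = e) ∨
        ((∃ p : Fin b × Fin b, (ra p.1, xc p) = e) ∨ ∃ p : Fin b × Fin b, (yr p, xc p) = e) ∨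
          ∃ p : Fin b × Fin b, (yr p, cb p.2) = e := by
    classical
    refine ⟨(Finset.univ.image fun i => (π₀ i, i)) ∪ (Finset.univ.image fun i => (ρ₀ i, i)) ∪
      ((Finset.univ.image fun p : Fin b × Fin b => (ra p.1, xc p)) ∪
        (Finset.univ.image fun p : Fin b × Fin b => (yr p, xc p)) ∪
        (Finset.univ.image fun p : Fin b × Fin b => (yr p, cb p.2))), fun e => ?_⟩
    simp only [Finset.mem_union, Finset.mem_image, Finset.mem_univ, true_and]
  -- the leftover bijection
  obtain ⟨φ, hφlt, hφinj, hφleft⟩ := exists_phi n K hKn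
  obtain ⟨μ, hμ⟩ := exists_mu ρ₀ col hinj hsurj φ hφlt hφinj
  -- chords have gadget columns and gadget rows
  have hcol_of_chord : ∀ e ∈ A, π₀ e.2 ≠ e.1 → ρ₀ e.2 ≠ e.1 → ∃ s < K, e.2 = col (6 * s + 3) := by
    intro e he hπ hρ
    rcases (hA e).1 he with (⟨i, rfl⟩ | ⟨i, rfl⟩) | ((⟨p, rfl⟩ | ⟨p, rfl⟩) | ⟨p, rfl⟩)
    · exact (hπ rfl).elim
    · exact (hρ rfl).elim
    · exact ⟨slot p, (hslot p).2, hxc p⟩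
    · exact ⟨slot p, (hslot p).2, hxc p⟩
    · exact ⟨p.2.val, lt_of_lt_of_le p.2.isLt hbK, hcb p.2⟩
  have hrow_of_chord : ∀ e ∈ A, π₀ e.2 ≠ e.1 → ρ₀ e.2 ≠ e.1 → ∃ s < K, e.1 = ρ₀ (col (6 * s)) := by
    intro e he hπ hρ
    rcases (hA e).1 he with (⟨i, rfl⟩ | ⟨i, rfl⟩) | ((⟨p, rfl⟩ | ⟨p, rfl⟩) | ⟨p, rfl⟩)
    · exact (hπ rfl).elim
    · exact (hρ rfl).elim
    · exact ⟨p.1.val, lt_of_lt_of_le p.1.isLt hbK, hra p.1⟩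
    · exact ⟨slot p, (hslot p).2, hyr p⟩
    · exact ⟨slot p, (hslot p).2, hyr p⟩
  refine ⟨A, fun i => ⟨(hA _).2 (Or.inl (Or.inl ⟨i, rfl⟩)), (hA _).2 (Or.inl (Or.inr ⟨i, rfl⟩))⟩,
    ?_, ra, cb, xc, yr, μ, ?_, ?_, ?_, ?_, ?_, ?_, ?_, ?_⟩
  · -- rigidity: chord columns are `H₀`-non-adjacent to chord rows
    intro e he e' he' hπ hρ hπ' hρ' _
    obtain ⟨s, hs, hse⟩ := hcol_of_chord e he hπ hρ
    obtain ⟨s', hs', hse'⟩ := hrow_of_chord e' he' hπ' hρ'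
    have hstep' : π₀ (col (6 * s + 3)) = ρ₀ (col (6 * s + 2)) := hstep (6 * s + 2)
    rw [hse, hse', hstep']
    constructor
    · intro h
      have := hrow _ _ (by omega) (by omega) h
      omega
    · intro h
      have := hrow _ _ (by omega) (by omega) h
      omega
  · -- `ra` injective
    intro a a' h
    rw [hra, hra] at h
    have ha := a.isLt
    have ha' := a'.isLt
    exact Fin.ext (by have := hrow _ _ (by omega) (by omega) h; omega)
  · -- `cb` injective
    intro a a' h
    rw [hcb, hcb] at h
    have ha := a.isLt
    have ha' := a'.isLt
    exact Fin.ext (by have := hinj _ _ (by omega) (by omega) h; omega)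
  · -- `xc` injective
    intro p q h
    rw [hxc, hxc] at h
    have hp := (hslot p).2
    have hq := (hslot q).2
    exact hslot_inj (by have := hinj _ _ (by omega) (by omega) h; omega)
  · -- `yr` injective
    intro p q h
    rw [hyr, hyr] at h
    have hp := (hslot p).2
    have hq := (hslot q).2
    exact hslot_inj (by have := hrow _ _ (by omega) (by omega) h; omega)
  · -- core rows miss internal rows
    intro a p h
    rw [hra, hyr] at h
    have ha := a.isLt
    have hp := hslot p
    have := hrow _ _ (by omega) (by omega) h
    omega
  · -- core columns miss internal columns
    intro b' p h
    rw [hcb, hxc] at h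
    have hb' := b'.isLt
    have hp := hslot p
    have := hinj _ _ (by omega) (by omega) h
    omega
  · -- the gadget cells lie in the host
    intro p
    exact ⟨(hA _).2 (Or.inr (Or.inl (Or.inl ⟨p, rfl⟩))),
      (hA _).2 (Or.inr (Or.inl (Or.inr ⟨p, rfl⟩))), (hA _).2 (Or.inr (Or.inr ⟨p, rfl⟩))⟩
  · -- the leftover matching
    intro c hcb' hxc'
    obtain ⟨t, ht, rfl⟩ := hsurj c
    have hleft : ¬(t < 6 * K ∧ t % 6 = 3) := by
      rintro ⟨h1, h2⟩
      by_cases hsb : t / 6 < b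
      · refine hcb' ⟨t / 6, hsb⟩ ?_
        rw [hcb]
        exact congrArg col (show 6 * (t / 6) + 3 = t by omega)
      · obtain ⟨p, hp⟩ := hslot_surj (t / 6) (by omega) (by omega)
        refine hxc' p ?_
        rw [hxc, hp]
        exact congrArg col (by omega)
    obtain ⟨hφcases, hφne⟩ := hφleft t ht hleft
    have hφt := hφlt t ht
    refine ⟨fun a h => ?_, fun p h => ?_, ?_⟩
    · rw [hra, hμ t ht] at h
      have ha := a.isLt
      exact hφne a.val (by omega) (hrow _ _ hφt (by omega) h.symm)
    · rw [hyr, hμ t ht] at h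
      have hp := hslot p
      exact hφne (slot p) hp.2 (hrow _ _ hφt (by omega) h.symm)
    · rw [hμ t ht]
      rcases hφcases with h | ⟨h1, h2⟩ | ⟨h1, h2⟩
      · rw [h]
        exact (hA _).2 (Or.inl (Or.inr ⟨_, rfl⟩))
      · have h3 : ρ₀ (col (φ t)) = π₀ (col t) := by
          rw [h2, ← hstep, Nat.sub_add_cancel h1]
        rw [h3]
        exact (hA _).2 (Or.inl (Or.inl ⟨_, rfl⟩))
      · have h3 : ρ₀ (col (φ t)) = π₀ (col t) := by
          rw [h2, ← hstep, Nat.sub_add_cancel hn, hper, h1]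
        rw [h3]
        exact (hA _).2 (Or.inl (Or.inl ⟨_, rfl⟩))

/-! ### The registered stub -/

/-- **Stub H (gadget placement on a Hamiltonian 2-factor).**  If `H₀ = π₀ ⊔ ρ₀` is Hamiltonian
(`π₀⁻¹ρ₀` an `n`-cycle), then for `n ≥ 2` there is a chord set making `A = H₀ ∪ chords` rigid in
the sense of `stub_twoFactorRigidity` (chord columns `H₀`-non-adjacent to chord rows) and containing
a placed gadget of order `b = ⌊√(n/24)⌋`: gadget rows at `ρ₀ (τ^{6s} c₀)`, gadget columns at
`τ^{6s+3} c₀` (`τ = π₀⁻¹ρ₀`, `s < b + b²`), all gadget edges as chords, and the remaining vertices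
matched along `H₀` (`μ c ∈ {ρ₀ c, π₀ c}` off the gadget rows). [folklore] -/
theorem stub_gadgetPlacement :
    ∃ n₀ : ℕ, ∀ n ≥ n₀, ∀ (π₀ ρ₀ : Equiv.Perm (Fin n)),
      (π₀⁻¹ * ρ₀).IsCycle → (π₀⁻¹ * ρ₀).support = Finset.univ →
      ∃ A : Finset (Fin n × Fin n),
        (∀ i, (π₀ i, i) ∈ A ∧ (ρ₀ i, i) ∈ A) ∧
        (∀ e ∈ A, ∀ e' ∈ A, π₀ e.2 ≠ e.1 → ρ₀ e.2 ≠ e.1 → π₀ e'.2 ≠ e'.1 → ρ₀ e'.2 ≠ e'.1 →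
          e ≠ e' → π₀ e.2 ≠ e'.1 ∧ ρ₀ e.2 ≠ e'.1) ∧
        ∃ (ra cb : Fin (Nat.sqrt (n / 24)) → Fin n)
          (xc yr : Fin (Nat.sqrt (n / 24)) × Fin (Nat.sqrt (n / 24)) → Fin n)
          (μ : Equiv.Perm (Fin n)),
          Function.Injective ra ∧ Function.Injective cb ∧ Function.Injective xc ∧
          Function.Injective yr ∧
          (∀ a p, ra a ≠ yr p) ∧ (∀ b' p, cb b' ≠ xc p) ∧
          (∀ p, (ra p.1, xc p) ∈ A ∧ (yr p, xc p) ∈ A ∧ (yr p, cb p.2) ∈ A) ∧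
          (∀ c : Fin n, (∀ b', cb b' ≠ c) → (∀ p, xc p ≠ c) →
            (∀ a, ra a ≠ μ c) ∧ (∀ p, yr p ≠ μ c) ∧ (μ c, c) ∈ A) := by
  refine ⟨2, fun n hn π₀ ρ₀ hc hs => ?_⟩
  obtain ⟨col, hstep, hinj, hsurj, hper⟩ := exists_orbit (by omega) π₀ ρ₀ hc hs
  have hKn : 6 * (Nat.sqrt (n / 24) + Nat.sqrt (n / 24) * Nat.sqrt (n / 24)) + 1 ≤ n := by
    have h1 := Nat.sqrt_le (n / 24)
    have h2 := Nat.le_mul_self (Nat.sqrt (n / 24))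
    omega
  exact placement (by omega) π₀ ρ₀ (Nat.sqrt (n / 24)) hKn col hstep hinj hsurj hper

end Summit.ValiantsHypothesis.ValiantsHypothesis.Theorems.DivisionGap.PerCofactorDegreeReduction.GadgetPlacement

end
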